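import Summits.BirchSwinnertonDyer.BirchSwinnertonDyer.Theorems.SchneiderFreeAdditiveX3PotMultBranchIMCOfLowerHalves
import Summits.BirchSwinnertonDyer.BirchSwinnertonDyer.Theorems.SchneiderFreeAdditiveX3GordTwoBranchIMCTargetCurrency
import HarnessLib

/-!
# Route `SchneiderFreeAdditiveX3` (rung K1 door), cruxes `PotMultBranchIMC` (item stmt-BirchSwinnertonDyer-19176) and
# `GordTwoBranchIMC` (item 19177): the WHOLE door's two analytic cruxes sit between the rung leaf and
# «the lower half of BSD_p on the same X3 semistable-twist rows in analytic rank ≤ 1»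

Cell `bsd-schneider-ideate`, seat `bsd-schneider-door-c2` (prover, generation 3). HONEST FRAMING:
arithmetic bookkeeping on the route's own sockets and the tree's typed currency; NOTHING is asserted
about elliptic curves; the cruxes `PotMultBranchIMC` (NOT in print), `GordTwoBranchIMC` (PRE,
Keller–Yin arXiv:2410.23241 Thm. 3.5.1 ∘ value at 𝟙) and the control crux `AnticycControlAdditiveK`
stay OPEN; BSD is not advanced by this file; `--supports` material (helper).

Companion of `Theorems/SchneiderFreeAdditiveX3PotMultBranchIMCOfLowerHalves.lean` (door-c2 g3: §1 the
converse of `JointLowerManin` at every odd `p`; §2–§3 the (M) cell with the partner hypothesis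
`Additive.N10.LowerHalfM`). This file SHARPENS the partner hypothesis to the route's own rows and does
the (G-ord, `e = 2`) cell and the whole door:

* `stepL_subM_of_x3LowerHalves` / `stepL_subGordTwo_of_x3LowerHalves`: printed facts GZ, KO, GZK, MOD,
  GZ73 + the LOWER half of BSD_p (`MissingLowerBoundAt`) at the rank-ONE pairs of the cell + the lower
  half at the rank-ZERO pairs OF THE SAME X3 CELL (the Heegner-twist partner `Wd` of a class-X3 (M) /
  (G-ord, `e = 2`) curve is again class-X3 on the same cell: `classX3_twist_of_heegner`,
  `subSemistableTwist_twist_of_heegner`, `j`-invariance of (M)) ⟹ STEP L Manin-robust on the cell;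
* (imported) door-c3 g3's `gordTwoBranchIMC_of_kolyvagin_of_control_of_stepL_subGordTwo`
  (`…GordTwoBranchIMCTargetCurrency.lean`): Kolyvagin + r4 + the (G-ord, `e = 2`) half of the target ⟹
  `GordTwoBranchIMC` BY NAME;
* `branchCruxes_of_printedFacts_of_control_of_x3LowerHalves`: `PrintedFacts` + `AnticycControlAdditiveK`
  + ONE hypothesis — the lower half of BSD_p at every pair `(W, p)` with `r_an(W) ≤ 1`, `p` odd,
  `ClassX3 W p`, `SubSemistableTwist W p` — ⟹ `PotMultBranchIMC ∧ GordTwoBranchIMC`; its rank-one part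
  is the rung leaf `SchneiderFree.AdditiveX3RankOneLower`, its rank-zero part is implied by bsd-addord's
  `N10.LowerHalfM ∧ N10.LowerHalfGordTwo` (`branchCruxes_of_printedFacts_of_control_of_leaf_of_n10LowerHalves`).

Net, with door-c5's `additiveX3RankOneLower_of_printedFacts_of_cruxesK` (leaf ⟸ `PrintedFacts` + r2 +
r3 + r4): modulo print and the control crux, the door's two analytic cruxes TOGETHER are sandwiched
between «lower half of BSD_p on X3 ∧ semistable twist, `r_an = 1`» (the leaf) and «the same in
`r_an ≤ 1`» — the door trades the two branch main conjectures for EXACTLY the lower half of BSD_p on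
its own X3 rows in analytic ranks one AND zero, nothing more and nothing less up to the rank-zero rows.

References: Jetchev–Skinner–Wan, Camb. J. Math. 5 (2017) §7.3.1, §7.4.1 (arXiv:1512.06894 pp. 29–31);
Miller, LMS J. Comput. Math. 14 (2011) Def. 1.1; Gross 1991 Thm. 1.3 (Kolyvagin).
-/

noncomputable section

open scoped Classical

open WeierstrassCurve NumberField IsDedekindDomain Field
  Literature.NumberTheory.EllipticCurves
  Literature.NumberTheory.EllipticCurves.ModularForms
  Literature.NumberTheory.EllipticCurves.GreenbergSelmer
  Literature.NumberTheory.EllipticCurves.Rank1Residual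
  Literature.NumberTheory.EllipticCurves.Rank1Residual.Typed
  Summit.BirchSwinnertonDyer.Rank1Residual
  Summit.BirchSwinnertonDyer.Rank1Residual.X11b
  Summit.BirchSwinnertonDyer.Rank1Residual.X11b.AcSelmer
  Summit.BirchSwinnertonDyer.Rank1Residual.X11b.Halves
  Summit.BirchSwinnertonDyer.BirchSwinnertonDyer.Theses.SchneiderFreeAdditiveX3

-- D-0017 layout: summit = sub-problem, so `Summit.BirchSwinnertonDyer.BirchSwinnertonDyer.…` is the
-- mandated namespace (same option as the route's sockets files).
set_option linter.dupNamespace false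
set_option autoImplicit false

namespace Summit.BirchSwinnertonDyer.BirchSwinnertonDyer.Theorems.SchneiderFree

/-! ## §1 The Heegner-twist partner stays on the cell -/

/-- (M) is a `j`-invariant cell: `SubM Wd p ↔ SubM W p` for any model `Wd` of a quadratic twist of `W`.
[cite: SilvermanAEC2009, X.5 Cor. 5.4] -/
theorem subM_twist_iff_of_quadratic (W : WeierstrassCurve ℚ) [W.IsElliptic] (p : ℕ) [Fact p.Prime]
    {d : ℚ} (hd : d ≠ 0) {Wd : WeierstrassCurve ℚ} [Wd.IsElliptic]
    (hWd : ∃ C : VariableChange ℚ, C • W.quadraticTwist d = Wd) :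
    Additive.SubM Wd p ↔ Additive.SubM W p := by
  unfold Additive.SubM Additive.PotMult
  rw [AdditivePotMult.j_of_model_twist hd hWd]

/-- **(G-ord, `e = 2`) transports along the Heegner twist** for a class-X3 pair at an odd additive
`p`: `SubGordTwo W p → SubGordTwo Wd p` for a globally minimal model `Wd` of `E^{(d_K)}`, `K` imaginary
quadratic with odd `d_K` and the Heegner hypothesis for `N_E` (door-c5's
`subSemistableTwist_twist_of_heegner` lands in `SubM ∨ SubGordTwo`; `j`-invariance excludes (M)).
[cite: SilvermanAEC2009, X.5 Cor. 5.4 and VII.1 Prop. 1.3(b)] -/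
theorem subGordTwo_twist_of_heegner (W : WeierstrassCurve ℚ) [W.IsElliptic] [W.IsGloballyMinimal]
    (p : ℕ) [Fact p.Prime] (hp2 : p ≠ 2) (K : Type) [Field K] [NumberField K]
    (hK : IsImaginaryQuadratic K) (hodd : Odd (NumberField.discr K))
    (hHN : SatisfiesHeegnerHypothesis (W.conductorNorm ℤ) K) (hadd : Addv W p)
    {Wd : WeierstrassCurve ℚ} [Wd.IsElliptic] [Wd.IsGloballyMinimal] (Cd : VariableChange ℚ)
    (hWd : Cd • W.quadraticTwist (NumberField.discr K : ℚ) = Wd) (hG : Additive.SubGordTwo W p) :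
    Additive.SubGordTwo Wd p := by
  have hD0 : (NumberField.discr K : ℚ) ≠ 0 := by exact_mod_cast NumberField.discr_ne_zero K
  have hSd : Additive.SubSemistableTwist Wd p :=
    subSemistableTwist_twist_of_heegner p W hp2 K hK hodd hHN hadd Cd hWd (Or.inr hG)
  have hnotW : ¬ Additive.SubM W p := hG.1.1
  have hnotM : ¬ Additive.SubM Wd p := fun hM ↦
    hnotW ((subM_twist_iff_of_quadratic W p hD0 ⟨Cd, hWd⟩).mp hM)
  exact Or.resolve_left hSd hnotM

/-! ## §2 STEP L on each cell from the two lower halves ON THE SAME X3 CELL -/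

section StepL

variable
  (hGZ : ∀ (N : ℕ) [NeZero N] (W : WeierstrassCurve ℚ) (K : Type) [Field K] [NumberField K],
    gross_zagier N W K)
  (hKo : ∀ (N : ℕ) [NeZero N] (W : WeierstrassCurve ℚ) (K : Type) [Field K] [NumberField K],
    kolyvagin N W K)
  (hGZK : rank_eq_analyticRank_of_analyticRank_le_one) (hmod : hasEntireLFunction_rat)
  (hGZ73 : GrossZagier1986_thm_I_7_3)

include hGZ hKo hGZK hmod hGZ73

/-- **STEP L (Manin-robust) on the (M) cell from the two lower halves on the X3-(M) rows** (sharpens the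
companion file's `stepL_subM_of_lowerHalves`, whose rank-zero hypothesis was all of `N10.LowerHalfM`): GZ,
KO, GZK, MOD, GZ73 + `MissingLowerBoundAt` at every rank-ONE class-X3 (M) pair + `MissingLowerBoundAt` at
every rank-ZERO class-X3 (M) pair ⟹ `AdditiveStepLInputManinAt W p` on the cell. For each Heegner datum
the twist's globally minimal model `Wd` has `r_an = 0`, is class-X3 (`classX3_twist_of_heegner`) and (M)
(`j`-invariance); `Typed.joint_of_lower_of_lower` and `indexLowerBoundLeAt_of_jointLowerBoundAt` conclude.
CONDITIONAL; nothing asserted. [cite: JetchevSkinnerWan2017, §7.4.1 (arXiv:1512.06894 pp. 29–31)] [cite: Miller2011LMS, Def. 1.1] -/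
theorem stepL_subM_of_x3LowerHalves
    (hLow1 : ∀ (W : WeierstrassCurve ℚ) [W.IsElliptic] [W.IsGloballyMinimal] (p : ℕ) [Fact p.Prime],
      W.analyticRank = 1 → p ≠ 2 → ClassX3 W p → Additive.SubM W p → MissingLowerBoundAt W p)
    (hLow0 : ∀ (W : WeierstrassCurve ℚ) [W.IsElliptic] [W.IsGloballyMinimal] (p : ℕ) [Fact p.Prime],
      W.analyticRank = 0 → p ≠ 2 → ClassX3 W p → Additive.SubM W p → MissingLowerBoundAt W p) :
    ∀ (W : WeierstrassCurve ℚ) [W.IsElliptic] [W.IsGloballyMinimal] (p : ℕ) [Fact p.Prime],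
      W.analyticRank = 1 → p ≠ 2 → ClassX3 W p → Additive.SubM W p →
        AdditiveStepLInputManinAt W p := by
  intro W _ _ p _ hr hp2 hX hM N _ K _ _ Dt H ι P hr' _hloc hN hK hodd hunit hHe hLt hP _hnt
  have hD0 : (NumberField.discr K : ℚ) ≠ 0 := by exact_mod_cast NumberField.discr_ne_zero K
  haveI hEt : (W.quadraticTwist (NumberField.discr K : ℚ)).IsElliptic :=
    W.isElliptic_quadraticTwist hD0
  obtain ⟨Cd, hCd⟩ := hasGlobalMinimalModel_rat_holds (W.quadraticTwist (NumberField.discr K : ℚ))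
  set Wd : WeierstrassCurve ℚ := Cd • W.quadraticTwist (NumberField.discr K : ℚ) with hWd_def
  haveI : Wd.IsGloballyMinimal := hCd
  have hWd : Cd • W.quadraticTwist (NumberField.discr K : ℚ) = Wd := rfl
  have hrt : (W.quadraticTwist (NumberField.discr K : ℚ)).analyticRank = 0 :=
    ((W.quadraticTwist _).analyticRank_eq_zero_iff_holds (hmod _)).2 hLt
  have hrd : Wd.analyticRank = 0 := by rw [← hWd, analyticRank_smul, hrt]
  have hHN' : SatisfiesHeegnerHypothesis (W.conductorNorm ℤ) K := by rw [hN]; exact hHe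
  have hXd : ClassX3 Wd p := classX3_twist_of_heegner p W K hK hHN' hX Cd hWd
  have hMd : Additive.SubM Wd p := (subM_twist_iff_of_quadratic W p hD0 ⟨Cd, hWd⟩).mpr hM
  have hJ : JointLowerBoundAt W Wd p :=
    joint_of_lower_of_lower (hLow1 W p hr hp2 hX hM) (hLow0 Wd p hrd hp2 hXd hMd)
  exact indexLowerBoundLeAt_of_jointLowerBoundAt W p N K Dt H ι P (hGZ N W K) (hKo N W K) hGZK hmod
    hGZ73 hr hN hK hodd hunit hHe hLt hP Wd ⟨Cd, hWd⟩ hp2 hJ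

/-- **STEP L (Manin-robust) on the (G-ord, `e = 2`) cell from the two lower halves on the X3-(G-ord,
`e = 2`) rows** — the twin, with the partner transported by `subGordTwo_twist_of_heegner`. CONDITIONAL;
nothing asserted. [cite: JetchevSkinnerWan2017, §7.4.1 (arXiv:1512.06894 pp. 29–31)] [cite: Miller2011LMS, Def. 1.1] -/
theorem stepL_subGordTwo_of_x3LowerHalves
    (hLow1 : ∀ (W : WeierstrassCurve ℚ) [W.IsElliptic] [W.IsGloballyMinimal] (p : ℕ) [Fact p.Prime],
      W.analyticRank = 1 → p ≠ 2 → ClassX3 W p → Additive.SubGordTwo W p → MissingLowerBoundAt W p)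
    (hLow0 : ∀ (W : WeierstrassCurve ℚ) [W.IsElliptic] [W.IsGloballyMinimal] (p : ℕ) [Fact p.Prime],
      W.analyticRank = 0 → p ≠ 2 → ClassX3 W p → Additive.SubGordTwo W p → MissingLowerBoundAt W p) :
    ∀ (W : WeierstrassCurve ℚ) [W.IsElliptic] [W.IsGloballyMinimal] (p : ℕ) [Fact p.Prime],
      W.analyticRank = 1 → p ≠ 2 → ClassX3 W p → Additive.SubGordTwo W p →
        AdditiveStepLInputManinAt W p := by
  intro W _ _ p _ hr hp2 hX hG N _ K _ _ Dt H ι P hr' _hloc hN hK hodd hunit hHe hLt hP _hnt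
  have hD0 : (NumberField.discr K : ℚ) ≠ 0 := by exact_mod_cast NumberField.discr_ne_zero K
  haveI hEt : (W.quadraticTwist (NumberField.discr K : ℚ)).IsElliptic :=
    W.isElliptic_quadraticTwist hD0
  obtain ⟨Cd, hCd⟩ := hasGlobalMinimalModel_rat_holds (W.quadraticTwist (NumberField.discr K : ℚ))
  set Wd : WeierstrassCurve ℚ := Cd • W.quadraticTwist (NumberField.discr K : ℚ) with hWd_def
  haveI : Wd.IsGloballyMinimal := hCd
  have hWd : Cd • W.quadraticTwist (NumberField.discr K : ℚ) = Wd := rfl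
  have hrt : (W.quadraticTwist (NumberField.discr K : ℚ)).analyticRank = 0 :=
    ((W.quadraticTwist _).analyticRank_eq_zero_iff_holds (hmod _)).2 hLt
  have hrd : Wd.analyticRank = 0 := by rw [← hWd, analyticRank_smul, hrt]
  have hHN' : SatisfiesHeegnerHypothesis (W.conductorNorm ℤ) K := by rw [hN]; exact hHe
  have hXd : ClassX3 Wd p := classX3_twist_of_heegner p W K hK hHN' hX Cd hWd
  have hGd : Additive.SubGordTwo Wd p :=
    subGordTwo_twist_of_heegner W p hp2 K hK hodd hHN' hX.2 Cd hWd hG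
  have hJ : JointLowerBoundAt W Wd p :=
    joint_of_lower_of_lower (hLow1 W p hr hp2 hX hG) (hLow0 Wd p hrd hp2 hXd hGd)
  exact indexLowerBoundLeAt_of_jointLowerBoundAt W p N K Dt H ι P (hGZ N W K) (hKo N W K) hGZK hmod
    hGZ73 hr hN hK hodd hunit hHe hLt hP Wd ⟨Cd, hWd⟩ hp2 hJ

end StepL

/-! ## §3 The whole door -/

/-- **The WHOLE door, upper end, on the route's own rows**: `PrintedFacts` + the control crux
`AnticycControlAdditiveK` + ONE hypothesis — the lower half of BSD_p (`MissingLowerBoundAt W p`) at every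
pair with `r_an(W) ≤ 1`, `p ≠ 2`, `ClassX3 W p`, `SubSemistableTwist W p` (its `r_an = 1` part is the rung
leaf `SchneiderFree.AdditiveX3RankOneLower`; its `r_an = 0` part is the lower half at the Heegner-twist
partners) — ⟹ BOTH analytic cruxes `PotMultBranchIMC ∧ GordTwoBranchIMC`. With door-c5's
`additiveX3RankOneLower_of_printedFacts_of_cruxesK` (leaf ⟸ `PrintedFacts` + r2 + r3 + r4): modulo print
and control, the pair (r2, r3) sits between «lower half on X3 ∧ sst-twist, `r_an = 1`» and «the same in
`r_an ≤ 1`». CONDITIONAL; closes nothing; BSD is not proved by any of this.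
[cite: JetchevSkinnerWan2017, §7.4.1 (arXiv:1512.06894 p. 30)] [cite: Miller2011LMS, Def. 1.1] -/
theorem branchCruxes_of_printedFacts_of_control_of_x3LowerHalves (hF : PrintedFacts)
    (h4 : AnticycControlAdditiveK)
    (hLow : ∀ (W : WeierstrassCurve ℚ) [W.IsElliptic] [W.IsGloballyMinimal] (p : ℕ) [Fact p.Prime],
      W.analyticRank ≤ 1 → p ≠ 2 → ClassX3 W p → Additive.SubSemistableTwist W p →
        MissingLowerBoundAt W p) :
    PotMultBranchIMC ∧ GordTwoBranchIMC := by
  obtain ⟨hGZ, hKo, hGZK, hmod, -, -, hGZ73, -⟩ := hF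
  refine ⟨potMultBranchIMC_of_kolyvagin_of_control_of_stepL_subM hKo (h4 hKo)
      (stepL_subM_of_x3LowerHalves hGZ hKo hGZK hmod hGZ73
        (fun W _ _ p _ hr hp2 hX hM ↦ hLow W p hr.le hp2 hX (Or.inl hM))
        (fun W _ _ p _ hr hp2 hX hM ↦ hLow W p (by omega) hp2 hX (Or.inl hM))),
    gordTwoBranchIMC_of_kolyvagin_of_control_of_stepL_subGordTwo hKo (h4 hKo)
      (stepL_subGordTwo_of_x3LowerHalves hGZ hKo hGZK hmod hGZ73
        (fun W _ _ p _ hr hp2 hX hG ↦ hLow W p hr.le hp2 hX (Or.inr hG))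
        (fun W _ _ p _ hr hp2 hX hG ↦ hLow W p (by omega) hp2 hX (Or.inr hG)))⟩

/-- **The whole door, upper end, from named leaves**: `PrintedFacts` + `AnticycControlAdditiveK` + the rung
leaf `SchneiderFree.AdditiveX3RankOneLower` + bsd-addord's rank-zero conjectures `Additive.N10.LowerHalfM`
and `Additive.N10.LowerHalfGordTwo` (registered stubs of crux `MultLower` / the (G-ord, `e = 2`) rank-zero
lower half; they cover the class-X3 partners via `N10.cellM_or_cellGordTwo_of_classX3_of_subSemistableTwist`)
⟹ `PotMultBranchIMC ∧ GordTwoBranchIMC`. CONDITIONAL; closes nothing.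
[cite: JetchevSkinnerWan2017, §7.4.1 (arXiv:1512.06894 p. 30)] [cite: Miller2011LMS, Def. 1.1] -/
theorem branchCruxes_of_printedFacts_of_control_of_leaf_of_n10LowerHalves (hF : PrintedFacts)
    (h4 : AnticycControlAdditiveK) (hLeaf : AdditiveX3RankOneLower) (hLowM : Additive.N10.LowerHalfM)
    (hLowG : Additive.N10.LowerHalfGordTwo) : PotMultBranchIMC ∧ GordTwoBranchIMC := by
  refine branchCruxes_of_printedFacts_of_control_of_x3LowerHalves hF h4 ?_
  intro W _ _ p _ hr hp2 hX hS
  rcases Nat.lt_or_ge W.analyticRank 1 with h0 | h1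
  · have hr0 : W.analyticRank = 0 := by omega
    rcases Additive.N10.cellM_or_cellGordTwo_of_classX3_of_subSemistableTwist W p hp2 hX hS with hM | hG
    · exact hLowM W p hr0 hM
    · exact hLowG W p hr0 hG
  · exact hLeaf W p (le_antisymm hr h1) hp2 hX hS

end Summit.BirchSwinnertonDyer.BirchSwinnertonDyer.Theorems.SchneiderFree

end
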